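import Summits.QuantumFields.YangMills.Theorems.DiagonalMirrorRPRCubeSurgeryDefs
import Literature.MathematicalPhysics.QuantumFieldTheory.TiltedTorusSwapRP
import Literature.MathematicalPhysics.QuantumFieldTheory.LatticeSiteRPMechanism

/-!
# Crux `WeakCouplingHypercubicLimitRP` (stmt-QuantumFields-27398), line `Sketch`, stub D1′ `stub_oddTorusSwapPairingLiminf`, door C
# (`cube-surgery-decoupling`, card #114), S1a part 1/4: GEOMETRY of the diagonal site mirror `v = x₀ − x₁ = 0` in the free hypercube

Helper file (`--supports stmt-QuantumFields-27398 --as helper`) of the crux lead `lead-27398-D1` (gen 2; PICKED.md of record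
`Cruxes/WeakCouplingHypercubicLimitRP/PICKED.md`); part 1 of the proof of S1a `cubeHalfRP : CubeHalfRP G` (Fröhlich–Israel–Lieb–Simon site
reflection for the free hypercube `Q_R` inside the scheme's own torus, definitions in `…DiagonalMirrorRPRCubeSurgeryDefs`, p828144).

WHAT.  §1 centred representatives (`rep = ZMod.valMinAbs`): the swap `sitePerm (0 1)` swaps them, fixes exactly the mirror `v = 0`, and
inside the cube nothing wraps (`rep_shift`: `rep (x + eᵢ) = rep x + eᵢ` when `rep x i + 1 ≤ R`, `2R+1 ≤ S`).  §2 the six planes.  §3 the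
bookkeeping objects as constrained PARAMETERS (`d`/`τ` the swap on planes/plaquettes; `M` shared links = directions `2,3` on the mirror inside
`Q_R`; `P` the other closed-positive-half links; `cube ⊇ cut ∪ sh ∪ pos ∪ neg` the plaquette classes by the `v`-values of their corners) and
their combinatorics: `τ` is an involution preserving the cube (`τ_τ`, `plaqInCube_τ`), **`mem_neg_iff_τ_mem_pos`** (the swap exchanges
negative and positive plaquettes), disjointness (`cube_classes_disjoint`), and the LINK lemmas `edges_of_mem_pos` (all four links of a positive plaquette lie in the
closed positive half-cube), `edges_of_mem_sh` (shared plaquettes have shared links), `edges_of_mem_cut` (the half-plaquette `W₊ = U(x,e₀)U(x+e₀,e₁)`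
of a cut plaquette lies in the closed positive half-cube).

HONEST FRAMING: bookkeeping for an exact finite-volume identity (S1a `cubeHalfRP`, file `…DiagonalMirrorRPRCubeHalfRP`); nothing asymptotic,
no letter of door B or C is proved; D1′, ⟨27398⟩ and its heart S6i are OPEN; nothing here bears on the summit; the Yang–Mills mass gap is NOT
proved here or anywhere in the tree.  Definition-free (bookkeeping objects are parameters constrained by defining equations, sub-namespace
`HalfRP`); no instance, no notation, `autoImplicit false`.

References: J. Fröhlich, R. Israel, E. H. Lieb, B. Simon, Comm. Math. Phys. 62 (1978) 1, Thm 2.1; K. Osterwalder, E. Seiler, Ann. Phys. 110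
(1978) 440, §2; E. Seiler, LNP 159 (1982) Ch. 2.
-/

set_option autoImplicit false

noncomputable section

open scoped SchwartzMap ComplexConjugate ComplexOrder
open MeasureTheory Filter Topology Finset Complex
open Literature.MathematicalPhysics.QuantumLattice Literature.MathematicalPhysics.AQFT
  Literature.MathematicalPhysics.QuantumFieldTheory
open Literature.Probability.LatticeModels (box)
open Summit.QuantumFields.YangMills.Cruxes.DiagonalMirrorRPR.ParityBridgeColdTraces (E4)

namespace Summit.QuantumFields.YangMills.Cruxes.DiagonalMirrorRPR.CubeSurgery

namespace HalfRP

/-! ## §1 Geometry of the site mirror `v = x₀ − x₁ = 0` on the torus with centred representatives -/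

section Geometry

variable {S : ℕ} {R : ℕ}

/-- Centred representatives of the swapped site are the swapped representatives. -/
theorem rep_sitePerm_swap (x : Site 4 S) (μ : Fin 4) :
    rep S (sitePerm (Equiv.swap (0 : Fin 4) 1) x) μ = rep S x (Equiv.swap (0 : Fin 4) 1 μ) := by
  simp [rep, sitePerm_apply, Equiv.symm_swap]

/-- The swap fixes exactly the sites of the mirror `v = 0`. -/
theorem sitePerm_swap_eq_self_of_rep {x : Site 4 S} (h : rep S x 0 = rep S x 1) :
    sitePerm (Equiv.swap (0 : Fin 4) 1) x = x := by
  have h01 : x 0 = x 1 := (ZMod.valMinAbs_inj).1 h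
  funext μ
  rw [sitePerm_apply, Equiv.symm_swap]
  by_cases h0 : μ = 0
  · subst h0; rw [Equiv.swap_apply_left, h01]
  by_cases h1 : μ = 1
  · subst h1; rw [Equiv.swap_apply_right, h01]
  rw [Equiv.swap_apply_of_ne_of_ne h0 h1]

/-- Conversely, a site fixed by the swap lies on the mirror. -/
theorem rep_eq_of_sitePerm_swap_eq_self {x : Site 4 S} (h : sitePerm (Equiv.swap (0 : Fin 4) 1) x = x) :
    rep S x 0 = rep S x 1 := by
  have := congrFun h 1
  rw [sitePerm_apply, Equiv.symm_swap, Equiv.swap_apply_right] at this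
  simp [rep, this]

/-- **No wrapping inside the cube**: the centred representative of `x + eᵢ` in direction `i` is `rep x i + 1` when
`rep x i + 1 ≤ R` and `2R+1 ≤ S`; the other coordinates are unchanged. -/
theorem rep_shift [NeZero S] (hRS : 2 * R + 1 ≤ S) {x : Site 4 S} {i : Fin 4} (hi : rep S x i + 1 ≤ (R : ℤ)) (μ : Fin 4) :
    rep S (x.shift i) μ = rep S x μ + if μ = i then 1 else 0 := by
  by_cases hμ : μ = i
  · subst hμ
    simp only [rep, Site.shift, Pi.add_apply, Pi.single_eq_same, if_true]
    refine (ZMod.valMinAbs_spec _ _).2 ⟨?_, ?_, ?_⟩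
    · push_cast; rfl
    · have := (ZMod.valMinAbs_mem_Ioc (x μ)).1; linarith
    · have hR : (2 * R + 1 : ℤ) ≤ S := by exact_mod_cast hRS
      simp only [rep] at hi
      linarith
  · simp only [rep, Site.shift, Pi.add_apply, Pi.single_apply, if_neg hμ, add_zero]

end Geometry

/-! ## §2 The six planes -/

section Planes

/-- The six coordinate planes `i < j` of `ℤ⁴`. -/
theorem plane_cases (q : {q : Fin 4 × Fin 4 // q.1 < q.2}) :
    q.1 = (0, 1) ∨ q.1 = (0, 2) ∨ q.1 = (0, 3) ∨ q.1 = (1, 2) ∨ q.1 = (1, 3) ∨ q.1 = (2, 3) := by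
  obtain ⟨⟨i, j⟩, h⟩ := q
  fin_cases i <;> fin_cases j <;> simp at h ⊢

end Planes

/-! ## §3 Bookkeeping objects as constrained parameters (the file stays definition-free) -/

section Param

variable {G : Type} [Group G] [MeasurableSpace G] {S : ℕ} [NeZero S] {R : ℕ} (hRS : 2 * R + 1 ≤ S)
  {d : {q : Fin 4 × Fin 4 // q.1 < q.2} → {q : Fin 4 × Fin 4 // q.1 < q.2}}
  {τ : Plaquette 4 S → Plaquette 4 S}
  {M P : Finset (Edge 4 S)} {cube cut sh pos neg : Finset (Plaquette 4 S)}

variable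
  (hd : ∀ q, (d q).1 = if q.1 = ((0 : Fin 4), (1 : Fin 4)) then q.1
    else (Equiv.swap (0 : Fin 4) 1 q.1.1, Equiv.swap (0 : Fin 4) 1 q.1.2))
  (hτ : ∀ p, τ p = (sitePerm (Equiv.swap (0 : Fin 4) 1) p.1, d p.2))
  (hM : ∀ e, e ∈ M ↔ PosHalfEdge S R e ∧ (e.2 = 2 ∨ e.2 = 3) ∧ rep S e.1 0 = rep S e.1 1)
  (hP : ∀ e, e ∈ P ↔ PosHalfEdge S R e ∧ e ∉ M)
  (hcube : ∀ p, p ∈ cube ↔ PlaqInCube S R p)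
  (hcut : ∀ p, p ∈ cut ↔ PlaqInCube S R p ∧ p.2.1 = (0, 1) ∧ rep S p.1 0 = rep S p.1 1)
  (hsh : ∀ p, p ∈ sh ↔ PlaqInCube S R p ∧ p.2.1 = (2, 3) ∧ rep S p.1 0 = rep S p.1 1)
  (hpos : ∀ p, p ∈ pos ↔ PlaqInCube S R p ∧
    ((p.2.1.1 = 0 ∧ p.2.1.2 = 1 ∧ 1 ≤ rep S p.1 0 - rep S p.1 1) ∨
      (p.2.1.1 = 0 ∧ (p.2.1.2 = 2 ∨ p.2.1.2 = 3) ∧ 0 ≤ rep S p.1 0 - rep S p.1 1) ∨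
      (p.2.1.1 = 1 ∧ 1 ≤ rep S p.1 0 - rep S p.1 1) ∨ (p.2.1.1 = 2 ∧ 1 ≤ rep S p.1 0 - rep S p.1 1)))
  (hneg : neg = cube \ (cut ∪ sh ∪ pos))

/-! ### The plaquette swap `τ` -/

section Tau

include hd in
/-- `d` is an involution on the six planes. -/
theorem d_d (q : {q : Fin 4 × Fin 4 // q.1 < q.2}) : d (d q) = q := by
  apply Subtype.ext
  have h1 := hd q
  have h2 := hd (d q)
  rcases plane_cases q with h | h | h | h | h | h <;>
    · rw [h] at h1
      simp [Equiv.swap_apply_of_ne_of_ne] at h1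
      rw [h1] at h2
      simp [Equiv.swap_apply_of_ne_of_ne] at h2
      rw [h2, h]

omit [NeZero S] in
/-- The site swap is an involution. -/
theorem sitePerm_swap_sitePerm_swap (x : Site 4 S) :
    sitePerm (Equiv.swap (0 : Fin 4) 1) (sitePerm (Equiv.swap (0 : Fin 4) 1) x) = x := by
  funext μ; simp [sitePerm_apply, Equiv.symm_swap, Equiv.swap_apply_self]

include hd hτ in
omit [NeZero S] in
/-- `τ` is an involution. -/
theorem τ_τ (p : Plaquette 4 S) : τ (τ p) = p := by
  rw [hτ, hτ]
  simp only [sitePerm_swap_sitePerm_swap, d_d hd]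

include hd hτ in
omit [NeZero S] in
/-- The cube is swap-symmetric: `τ p ⊆ Q_R ↔ p ⊆ Q_R`. -/
theorem plaqInCube_τ (p : Plaquette 4 S) : PlaqInCube S R (τ p) ↔ PlaqInCube S R p := by
  rw [hτ]
  have h1 := hd p.2
  simp only [PlaqInCube, rep_sitePerm_swap]
  have hall : (∀ μ : Fin 4, |rep S p.1 (Equiv.swap (0 : Fin 4) 1 μ)| ≤ (R : ℤ)) ↔
      ∀ μ : Fin 4, |rep S p.1 μ| ≤ (R : ℤ) :=
    ⟨fun h μ => by simpa [Equiv.swap_apply_self] using h (Equiv.swap (0 : Fin 4) 1 μ), fun h μ => h _⟩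
  rw [hall]
  rcases plane_cases p.2 with h | h | h | h | h | h <;>
    · rw [h] at h1
      simp [Equiv.swap_apply_of_ne_of_ne] at h1
      simp only [h1, h, Equiv.swap_apply_left, Equiv.swap_apply_right]
      try tauto

end Tau

/-! ### Positive, negative, shared and cut plaquettes of the cube -/

section Classes

include hd hτ hcube hcut hsh hpos hneg in
omit [NeZero S] in
/-- **The swap exchanges negative and positive plaquettes**: `p ∈ neg ↔ τ p ∈ pos`. -/
theorem mem_neg_iff_τ_mem_pos (p : Plaquette 4 S) : p ∈ neg ↔ τ p ∈ pos := by
  rw [hneg, Finset.mem_sdiff, Finset.mem_union, Finset.mem_union, hcube, hcut, hsh, hpos, hpos,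
    plaqInCube_τ hd hτ p, hτ]
  have h1 := hd p.2
  simp only [rep_sitePerm_swap, Equiv.swap_apply_left, Equiv.swap_apply_right]
  by_cases hc : PlaqInCube S R p
  · simp only [hc, true_and]
    rcases plane_cases p.2 with h | h | h | h | h | h <;>
      · rw [h] at h1
        simp at h1
        simp only [h1, h, Fin.isValue, Prod.mk.injEq, true_and, and_true]
        simp
        omega
  · simp only [hc, false_and]

include hcube hcut hsh hpos in
omit [NeZero S] in
/-- `cut ∪ sh ∪ pos ⊆ cube`. -/
theorem union_subset_cube : cut ∪ sh ∪ pos ⊆ cube := by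
  intro p hp
  rw [hcube]
  rcases Finset.mem_union.1 hp with hp | hp
  · rcases Finset.mem_union.1 hp with hp | hp
    · exact ((hcut p).1 hp).1
    · exact ((hsh p).1 hp).1
  · exact ((hpos p).1 hp).1

include hcut hsh hpos in
omit [NeZero S] in
/-- The classes `cut`, `sh`, `pos` of cube plaquettes are pairwise disjoint (as needed to split the action). -/
theorem cube_classes_disjoint : Disjoint cut sh ∧ Disjoint (cut ∪ sh) pos := by
  constructor
  · rw [Finset.disjoint_left]
    intro p h1 h2
    have h := ((hcut p).1 h1).2.1
    have h' := ((hsh p).1 h2).2.1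
    rw [h] at h'
    exact absurd h' (by decide)
  · rw [Finset.disjoint_left]
    intro p h1 h2
    obtain ⟨-, h2⟩ := (hpos p).1 h2
    rcases Finset.mem_union.1 h1 with h1 | h1
    · obtain ⟨-, hq, hv⟩ := (hcut p).1 h1
      rw [hq] at h2
      simp at h2
      omega
    · obtain ⟨-, hq, hv⟩ := (hsh p).1 h1
      rw [hq] at h2
      simp at h2
      omega

include hneg in
omit [NeZero S] in
/-- `neg` is disjoint from `cut ∪ sh ∪ pos`. -/
theorem disjoint_union_neg : Disjoint (cut ∪ sh ∪ pos) neg := by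
  rw [hneg]; exact Finset.disjoint_sdiff

end Classes

/-! ### Links of the plaquettes of each class -/

section Links

include hRS in
/-- The representative of `x + eᵢ` in direction `i`. -/
theorem rep_shift_same {x : Site 4 S} {i : Fin 4} (hi : rep S x i + 1 ≤ (R : ℤ)) :
    rep S (x.shift i) i = rep S x i + 1 := by
  rw [rep_shift hRS hi, if_pos rfl]

include hRS in
/-- The representatives of `x + eᵢ` in the other directions. -/
theorem rep_shift_ne {x : Site 4 S} {i : Fin 4} (hi : rep S x i + 1 ≤ (R : ℤ)) {μ : Fin 4} (hμ : μ ≠ i) :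
    rep S (x.shift i) μ = rep S x μ := by
  rw [rep_shift hRS hi, if_neg hμ, add_zero]

include hRS in
/-- `x + eᵢ` stays in the cube. -/
theorem cube_shift {x : Site 4 S} {i : Fin 4} (hx : ∀ μ, |rep S x μ| ≤ (R : ℤ)) (hi : rep S x i + 1 ≤ (R : ℤ))
    (μ : Fin 4) : |rep S (x.shift i) μ| ≤ (R : ℤ) := by
  rw [rep_shift hRS hi]
  have h := hx μ
  have h' := hx i
  rw [abs_le] at h h' ⊢
  split_ifs with hμ
  · subst hμ; constructor <;> omega
  · simpa using h

include hRS hpos in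
/-- **The four links of a positive plaquette lie in the closed positive half-cube.** -/
theorem edges_of_mem_pos {p : Plaquette 4 S} (hp : p ∈ pos) :
    PosHalfEdge S R (p.1, p.2.1.1) ∧ PosHalfEdge S R (p.1.shift p.2.1.1, p.2.1.2) ∧
      PosHalfEdge S R (p.1.shift p.2.1.2, p.2.1.1) ∧ PosHalfEdge S R (p.1, p.2.1.2) := by
  obtain ⟨⟨hc, hi, hj⟩, hv⟩ := (hpos p).1 hp
  have hci := cube_shift hRS hc hi
  have hcj := cube_shift hRS hc hj
  simp only [PosHalfEdge]
  have hri := rep_shift hRS hi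
  have hrj := rep_shift hRS hj
  rcases plane_cases p.2 with h | h | h | h | h | h <;>
    · rw [h] at hv hi hj hci hcj hri hrj ⊢
      simp only [Fin.isValue] at hv hi hj hci hcj hri hrj ⊢
      simp only [hri, hrj] at hci hcj ⊢
      simp only [hc, hci, hcj, implies_true, true_and, dv]
      simp at hv ⊢
      omega


include hRS hM hsh in
/-- **The four links of a shared plaquette are shared** (directions `2, 3` on the mirror, inside the cube). -/
theorem edges_of_mem_sh {p : Plaquette 4 S} (hp : p ∈ sh) :
    (p.1, p.2.1.1) ∈ M ∧ (p.1.shift p.2.1.1, p.2.1.2) ∈ M ∧ (p.1.shift p.2.1.2, p.2.1.1) ∈ M ∧ (p.1, p.2.1.2) ∈ M := by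
  obtain ⟨⟨hc, hi, hj⟩, hq, hv⟩ := (hsh p).1 hp
  have hci := cube_shift hRS hc hi
  have hcj := cube_shift hRS hc hj
  have hri := rep_shift hRS hi
  have hrj := rep_shift hRS hj
  simp only [hM, PosHalfEdge]
  rw [hq] at hi hj hci hcj hri hrj ⊢
  simp only [Fin.isValue] at hi hj hci hcj hri hrj ⊢
  simp only [hri, hrj] at hci hcj ⊢
  simp only [hc, hci, hcj, implies_true, true_and, dv]
  simp
  omega

include hRS hcut in
/-- The two links `(x, e₀)`, `(x + e₀, e₁)` of the half-plaquette `W₊` of a cut plaquette lie in the closed positive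
half-cube. -/
theorem edges_of_mem_cut {p : Plaquette 4 S} (hp : p ∈ cut) :
    PosHalfEdge S R (p.1, 0) ∧ PosHalfEdge S R (p.1.shift 0, 1) := by
  obtain ⟨⟨hc, hi, hj⟩, hq, hv⟩ := (hcut p).1 hp
  rw [hq] at hi hj
  simp only [Fin.isValue] at hi hj
  have hci := cube_shift hRS hc hi
  have hri := rep_shift hRS hi
  simp only [PosHalfEdge]
  simp only [hri] at hci ⊢
  simp only [hc, hci, implies_true, true_and, dv]
  simp
  omega

end Links

end Param

end HalfRP

end Summit.QuantumFields.YangMills.Cruxes.DiagonalMirrorRPR.CubeSurgery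

end
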